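import Mathlib.Geometry.Manifold.MFDeriv.Atlas
import Mathlib.Geometry.Manifold.ContMDiff.Atlas
import Mathlib.Geometry.Manifold.ContMDiff.NormedSpace
import Mathlib.Geometry.Manifold.Diffeomorph
import Mathlib.Geometry.Manifold.Instances.Sphere
import Mathlib.Geometry.Manifold.LocalDiffeomorph
import HarnessLib

/-!
# A compact subset of a chart domain has a neighbourhood embedding in every manifold of the same model

Topic `Literature/Geometry/Manifold` (general manifold plumbing; folklore).  Let `M` and `X` be
`C^∞` manifolds modelled on the same real normed space `E` (boundaryless model `𝓘(ℝ, E)`), `X`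
non-empty, and let `K ⊆ M` be a compact set contained in the domain of ONE extended chart
`φ = extChartAt 𝓘(ℝ, E) x₀`.  Then an open neighbourhood `U` of `K` embeds into `X` by a map
`J : M → X` that is `C^∞`, injective and has bijective differential on `U`: `φ(K)` is bounded,
say `⊆ B(0, R)`; a chart `ψ` of `X` at any point has a target containing a ball `B(ψ x₁, r)`;
take `U = φ⁻¹(B(0, R))` and `J = ψ⁻¹ ∘ (y ↦ ψ x₁ + (r/R) y) ∘ φ`
(`exists_nhd_embedding_of_isCompact_subset_extChartAt_source`).  The shape of the conclusion —
`ContMDiffOn ∧ InjOn ∧ ∀ x ∈ U, Bijective (mfderiv J x)` on an open `U ⊇ K` — is the one used by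
the tree's four-manifold statements for "a neighbourhood of `K` smoothly embeds"
(e.g. the host clause of line `stable-seam-host` of crux `OrigamiFoldExistence`).

Consequences recorded here:
* `sphere_compl_singleton_subset_extChartAt_source` — on the round sphere `Sⁿ ⊂ E`
  (`dim E = n + 1`, Mathlib's stereographic atlas) the extended chart at `-p` has domain `{p}ᶜ`,
  so every compact `K ⊆ Sⁿ` missing a point lies in one chart domain;
* `exists_nhd_embedding_of_isCompact_sphere` — hence a neighbourhood of any compact `K ⊊ Sⁿ`
  embeds into every non-empty `n`-manifold charted on `ℝⁿ`;
* `exists_nhd_embedding_of_isCompact_of_diffeomorph_sphere` — the same for a manifold `M`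
  DIFFEOMORPHIC to `Sⁿ` (transport along the diffeomorphism: `J ∘ Ψ` on `Ψ⁻¹(U)`).

Everything is proved; no named facts.  (Lee, *Introduction to Smooth Manifolds* (2013), Ch. 1
(stereographic coordinates, Problem 1-7), Prop. 3.6 (differentials of diffeomorphisms); the
embedding statement itself is folklore.)
-/

noncomputable section

open scoped Manifold ContDiff Topology
open Set Function Metric

namespace Literature.Geometry.Manifold

section General

variable {E : Type*} [NormedAddCommGroup E] [NormedSpace ℝ E]
  {M : Type*} [TopologicalSpace M] [ChartedSpace E M] [IsManifold 𝓘(ℝ, E) ∞ M]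
  {X : Type*} [TopologicalSpace X] [ChartedSpace E X] [IsManifold 𝓘(ℝ, E) ∞ X]

/-- The differential of an extended chart is bijective on the chart domain (Mathlib's
`isInvertible_mfderiv_extChartAt`). [folklore] -/
theorem bijective_mfderiv_extChartAt {x₀ y : M} (hy : y ∈ (extChartAt 𝓘(ℝ, E) x₀).source) :
    Bijective (mfderiv 𝓘(ℝ, E) 𝓘(ℝ, E) (extChartAt 𝓘(ℝ, E) x₀) y) := by
  obtain ⟨A, hA⟩ := isInvertible_mfderiv_extChartAt (I := 𝓘(ℝ, E)) hy
  rw [← hA]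
  exact A.bijective

/-- The differential of the inverse of an extended chart is bijective on the chart target
(Mathlib's `isInvertible_mfderivWithin_extChartAt_symm`, boundaryless model). [folklore] -/
theorem bijective_mfderiv_extChartAt_symm {x₀ : M} {z : E}
    (hz : z ∈ (extChartAt 𝓘(ℝ, E) x₀).target) :
    Bijective (mfderiv 𝓘(ℝ, E) 𝓘(ℝ, E) (extChartAt 𝓘(ℝ, E) x₀).symm z) := by
  obtain ⟨A, hA⟩ := isInvertible_mfderivWithin_extChartAt_symm (I := 𝓘(ℝ, E)) hz
  rw [modelWithCornersSelf_coe, range_id, mfderivWithin_univ] at hA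
  rw [← hA]
  exact A.bijective

/-- The inverse of an extended chart is differentiable on the chart target (boundaryless
model). [folklore] -/
theorem mdifferentiableAt_extChartAt_symm {x₀ : M} {z : E}
    (hz : z ∈ (extChartAt 𝓘(ℝ, E) x₀).target) :
    MDifferentiableAt 𝓘(ℝ, E) 𝓘(ℝ, E) (extChartAt 𝓘(ℝ, E) x₀).symm z := by
  have h := mdifferentiableWithinAt_extChartAt_symm (I := 𝓘(ℝ, E)) hz
  rwa [modelWithCornersSelf_coe, range_id, mdifferentiableWithinAt_univ] at h

/-- **A compact subset of a chart domain has a neighbourhood that embeds into every non-empty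
manifold with the same model.**  For `K ⊆ (extChartAt 𝓘(ℝ, E) x₀).source` compact and `X`
non-empty there are an open `U ⊇ K` and `J : M → X`, `C^∞` and injective on `U` with bijective
differential at every point of `U` (`J = ψ⁻¹ ∘ (ψ x₁ + (r/R) ·) ∘ φ` on `U = φ⁻¹ B(0, R)`).
[folklore] -/
theorem exists_nhd_embedding_of_isCompact_subset_extChartAt_source [Nonempty X] {K : Set M}
    (hK : IsCompact K) {x₀ : M} (hKs : K ⊆ (extChartAt 𝓘(ℝ, E) x₀).source) :
    ∃ (U : Set M) (J : M → X), IsOpen U ∧ K ⊆ U ∧ ContMDiffOn 𝓘(ℝ, E) 𝓘(ℝ, E) ∞ J U ∧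
      InjOn J U ∧ ∀ x ∈ U, Bijective (mfderiv 𝓘(ℝ, E) 𝓘(ℝ, E) J x) := by
  set φ := extChartAt 𝓘(ℝ, E) x₀ with hφ
  obtain ⟨x₁⟩ := ‹Nonempty X›
  set ψ := extChartAt 𝓘(ℝ, E) x₁ with hψ
  -- `φ(K)` is bounded
  have hKc : IsCompact (φ '' K) :=
    hK.image_of_continuousOn ((continuousOn_extChartAt x₀).mono hKs)
  obtain ⟨R, hR0, hKR⟩ := hKc.isBounded.subset_ball_lt 0 (0 : E)
  -- a ball in the target of `ψ`
  obtain ⟨r, hr0, hball⟩ := Metric.mem_nhds_iff.1 (extChartAt_target_mem_nhds (I := 𝓘(ℝ, E)) x₁)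
  rw [← hψ] at hball
  set t : ℝ := r / R with ht
  have ht0 : 0 < t := div_pos hr0 hR0
  set L : E →L[ℝ] E := t • ContinuousLinearMap.id ℝ E with hL
  set A : E → E := fun y => ψ x₁ + L y with hA
  have hLy : ∀ y, L y = t • y := fun y => by simp [hL]
  have hA_maps : ∀ y ∈ ball (0 : E) R, A y ∈ ψ.target := by
    intro y hy
    apply hball
    rw [mem_ball_zero_iff] at hy
    rw [Metric.mem_ball, dist_eq_norm, hA]
    dsimp only
    rw [add_sub_cancel_left, hLy]
    calc ‖t • y‖ = t * ‖y‖ := by rw [norm_smul, Real.norm_of_nonneg ht0.le]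
      _ < t * R := mul_lt_mul_of_pos_left hy ht0
      _ = r := div_mul_cancel₀ r hR0.ne'
  have hAd : ∀ y, HasFDerivAt A L y := fun y => by
    simpa [hA] using (L.hasFDerivAt (x := y)).const_add (ψ x₁)
  have hAc : ContMDiff 𝓘(ℝ, E) 𝓘(ℝ, E) ∞ A :=
    (contDiff_const.add L.contDiff).contMDiff
  have hLbij : Bijective L := by
    refine ⟨fun a b h => ?_, fun b => ⟨t⁻¹ • b, ?_⟩⟩
    · rw [hLy, hLy] at h
      exact smul_right_injective E ht0.ne' h
    · rw [hLy, smul_inv_smul₀ ht0.ne']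
  refine ⟨φ.source ∩ φ ⁻¹' ball 0 R, fun x => ψ.symm (A (φ x)), ?_, ?_, ?_, ?_, ?_⟩
  · exact (continuousOn_extChartAt x₀).isOpen_inter_preimage (isOpen_extChartAt_source x₀)
      isOpen_ball
  · exact fun x hx => ⟨hKs hx, hKR ⟨x, hx, rfl⟩⟩
  · -- smoothness
    have h1 : ContMDiffOn 𝓘(ℝ, E) 𝓘(ℝ, E) ∞ φ φ.source := by
      rw [hφ, extChartAt_source]
      exact contMDiffOn_extChartAt
    have h3 : ContMDiffOn 𝓘(ℝ, E) 𝓘(ℝ, E) ∞ ψ.symm ψ.target := contMDiffOn_extChartAt_symm x₁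
    refine h3.comp ((hAc.comp_contMDiffOn h1).mono inter_subset_left) ?_
    intro x hx
    exact hA_maps _ hx.2
  · -- injectivity
    intro x hx y hy hxy
    have h1 : A (φ x) = A (φ y) := ψ.symm.injOn (hA_maps _ hx.2) (hA_maps _ hy.2) hxy
    have h2 : φ x = φ y := hLbij.1 (add_left_cancel h1)
    exact φ.injOn hx.1 hy.1 h2
  · -- bijective differential
    intro x hx
    have hφd : MDifferentiableAt 𝓘(ℝ, E) 𝓘(ℝ, E) φ x :=
      mdifferentiableAt_extChartAt (by rw [← extChartAt_source (I := 𝓘(ℝ, E))]; exact hx.1)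
    have hAd' : MDifferentiableAt 𝓘(ℝ, E) 𝓘(ℝ, E) A (φ x) :=
      (hAc.mdifferentiable (by simp)) _
    have hψd : MDifferentiableAt 𝓘(ℝ, E) 𝓘(ℝ, E) ψ.symm (A (φ x)) :=
      mdifferentiableAt_extChartAt_symm (hA_maps _ hx.2)
    have hcomp : mfderiv 𝓘(ℝ, E) 𝓘(ℝ, E) (fun x => ψ.symm (A (φ x))) x =
        (mfderiv 𝓘(ℝ, E) 𝓘(ℝ, E) ψ.symm (A (φ x))).comp
          ((mfderiv 𝓘(ℝ, E) 𝓘(ℝ, E) A (φ x)).comp (mfderiv 𝓘(ℝ, E) 𝓘(ℝ, E) φ x)) := by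
      have e1 := mfderiv_comp x hψd (hAd'.comp x hφd)
      rw [mfderiv_comp x hAd' hφd] at e1
      exact e1
    have hAm : mfderiv 𝓘(ℝ, E) 𝓘(ℝ, E) A (φ x) = L := by
      rw [mfderiv_eq_fderiv, (hAd _).fderiv]
    rw [hcomp, hAm]
    exact (bijective_mfderiv_extChartAt_symm (hA_maps _ hx.2)).comp
      (hLbij.comp (bijective_mfderiv_extChartAt hx.1))

end General

/-! ### The round sphere: a compact set missing a point lies in one stereographic chart -/

section Sphere

variable {E : Type*} [NormedAddCommGroup E] [InnerProductSpace ℝ E] {n : ℕ}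
  [Fact (Module.finrank ℝ E = n + 1)]

/-- The domain of the extended (stereographic) chart of the unit sphere at `-p` is `{p}ᶜ`
(Mathlib's `stereographic'_source`; Lee 2013, Problem 1-7). [folklore] -/
theorem extChartAt_neg_sphere_source (p : sphere (0 : E) 1) :
    (extChartAt (𝓡 n) (-p)).source = {p}ᶜ := by
  rw [extChartAt_source]
  simp [chartAt, ChartedSpace.chartAt, stereographic'_source]

/-- A subset of the sphere missing the point `p` lies in the domain of the extended chart at
`-p`. [folklore] -/
theorem subset_extChartAt_neg_sphere_source {K : Set (sphere (0 : E) 1)} {p : sphere (0 : E) 1}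
    (hp : p ∉ K) : K ⊆ (extChartAt (𝓡 n) (-p)).source := by
  rw [extChartAt_neg_sphere_source]
  exact fun x hx hxp => hp (by rwa [mem_singleton_iff.1 hxp] at hx)

variable {X : Type*} [TopologicalSpace X] [ChartedSpace (EuclideanSpace ℝ (Fin n)) X]
  [IsManifold (𝓡 n) ∞ X]

/-- **A neighbourhood of a compact proper subset of the round sphere embeds into every non-empty
`n`-manifold charted on `ℝⁿ`**: for `K ⊆ Sⁿ` compact and `p ∉ K` there are an open `U ⊇ K`
and `J : Sⁿ → X`, `C^∞` and injective on `U` with bijective differential on `U`. [folklore] -/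
theorem exists_nhd_embedding_of_isCompact_sphere [Nonempty X] {K : Set (sphere (0 : E) 1)}
    (hK : IsCompact K) {p : sphere (0 : E) 1} (hp : p ∉ K) :
    ∃ (U : Set (sphere (0 : E) 1)) (J : sphere (0 : E) 1 → X), IsOpen U ∧ K ⊆ U ∧
      ContMDiffOn (𝓡 n) (𝓡 n) ∞ J U ∧ InjOn J U ∧
      ∀ x ∈ U, Bijective (mfderiv (𝓡 n) (𝓡 n) J x) :=
  exists_nhd_embedding_of_isCompact_subset_extChartAt_source hK
    (subset_extChartAt_neg_sphere_source hp)

/-- **The same for a manifold diffeomorphic to the round sphere**: if `Ψ : M ≅ Sⁿ` is a `C^∞`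
diffeomorphism, `K ⊆ M` is compact and `p ∉ K`, a neighbourhood of `K` embeds into every
non-empty `n`-manifold charted on `ℝⁿ` (transport: `J ∘ Ψ` on `Ψ⁻¹(U)`, Lee 2013 Prop. 3.6 for
the differential of `Ψ`). [folklore] -/
theorem exists_nhd_embedding_of_isCompact_of_diffeomorph_sphere [Nonempty X] {M : Type*}
    [TopologicalSpace M] [ChartedSpace (EuclideanSpace ℝ (Fin n)) M] [IsManifold (𝓡 n) ∞ M]
    (Ψ : M ≃ₘ⟮𝓡 n, 𝓡 n⟯ sphere (0 : E) 1) {K : Set M} (hK : IsCompact K) {p : M} (hp : p ∉ K) :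
    ∃ (U : Set M) (J : M → X), IsOpen U ∧ K ⊆ U ∧ ContMDiffOn (𝓡 n) (𝓡 n) ∞ J U ∧ InjOn J U ∧
      ∀ x ∈ U, Bijective (mfderiv (𝓡 n) (𝓡 n) J x) := by
  have hK' : IsCompact (Ψ '' K) := hK.image Ψ.continuous
  have hp' : Ψ p ∉ Ψ '' K := fun ⟨q, hq, hqp⟩ => hp (by rwa [← EquivLike.injective Ψ hqp])
  obtain ⟨U, J, hUo, hKU, hJ, hJi, hJd⟩ :=
    exists_nhd_embedding_of_isCompact_sphere (n := n) (X := X) hK' hp'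
  have hΨd : MDifferentiable (𝓡 n) (𝓡 n) Ψ := Ψ.mdifferentiable (by simp)
  refine ⟨Ψ ⁻¹' U, J ∘ Ψ, hUo.preimage Ψ.continuous, fun x hx => hKU ⟨x, hx, rfl⟩,
    hJ.comp Ψ.contMDiff.contMDiffOn fun x hx => hx,
    fun x hx y hy hxy => EquivLike.injective Ψ (hJi hx hy hxy), fun x hx => ?_⟩
  rw [mfderiv_comp x ((hJ.contMDiffAt (hUo.mem_nhds hx)).mdifferentiableAt (by simp)) (hΨd x)]
  exact (hJd _ hx).comp (Ψ.mfderivToContinuousLinearEquiv (by simp) x).bijective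

end Sphere

end Literature.Geometry.Manifold

end
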